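import Summits.CriticalPhenomena.PercolationContinuityZ3.Theorems.PercNearOneGluingAdditiveGluingDKernelPin
import HarnessLib

/-! # Crux `PercNearOneGluing.AdditiveGluing` (stmt-CriticalPhenomena-4576) — MERGING relays in the designated-pocket kernel: a relay that is
# almost surely joined to another element of `A` may be dropped (seat (d) gen 1)

Support file (`--supports stmt-CriticalPhenomena-4576`); no definitions, no named facts.

`μ` any weighting (in the application the glued weighting `u/S`), relays `A ∋ b`, block `S`, designation `a₀`,
`D(A) : μ((⋃_{v∈S}⋃_{x∈A} v↔x) ∩ (a₀↔b)) ≤ μ(⋃_{v∈S} v↔b)`.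
* `dKernel_of_merge`: if `a, a' ∈ A`, `a ≠ a'`, `a' ≠ a₀` and `μ((a ↔ a')ᶜ) = 0`, then `D(A.erase a') → D(A)` — a block reaching `a'` a.s.
  reaches `a ∈ A.erase a'`.  (`a` may be `b` or `a₀`.)
* `dmerge_null_of_sure`: a weight-`1` pair `s(a,a')` gives `μ((a ↔ a')ᶜ) = 0` (`sigmaRec_conull`).
Use: the `k`-relay Theorem-2 certificate `dKernel_of_knThmK` needs all relays simultaneously separable with positive probability; when that
fails two relays are joined by a sure path, and merging lowers the number of relays (possibly to `A.card ≤ 3`, the base case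
`blockGood_cardLeThree_inf` + `dKernel_of_blockGood`).  Numerically idle on the campaigns of this seat (weights were capped at 0.98), but the
crux allows weight-`1` pairs.  [cite: KozmaNitzan2024, Remark after Lemma 4 p. 9 (gluing `G/{a₁,a₂}`), §3.2 p. 14]
-/

namespace Summit.CriticalPhenomena.PercolationContinuityZ3.Theorems

open MeasureTheory Set
open Literature.Probability.LatticeModels (prodBernoulli)
open Literature.Probability.Percolation (BondConfig openConn openConnIn openGraph openCluster)
open scoped BigOperators

noncomputable section
open Classical

section DKernelMerge

open Literature.Probability.LatticeModels Literature.Probability.Percolation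

variable {n : ℕ}

/-- A weight-`1` pair is almost surely open, so its endpoints are almost surely joined. [folklore] -/
theorem dmerge_null_of_sure (g : Sym2 (Fin n) → unitInterval) (a a' : Fin n) (haa : a ≠ a') (hg : g s(a, a') = 1) :
    (prodBernoulli g).real ((openConn a a')ᶜ : Set (BondConfig (Fin n))) = 0 := by
  have hle : ((openConn a a')ᶜ : Set (BondConfig (Fin n))) ⊆ ({ω : BondConfig (Fin n) | s(a, a') ∈ ω})ᶜ := by
    intro ω hω he
    exact hω (SimpleGraph.Adj.reachable ((openGraph_adj ω a a').2 ⟨he, haa⟩) : (openGraph ω).Reachable a a')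
  have h0 : prodBernoulli g ({ω : BondConfig (Fin n) | s(a, a') ∈ ω})ᶜ = 0 :=
    sigmaRec_conull g {ω : BondConfig (Fin n) | s(a, a') ∈ ω} fun ω hω => ⟨s(a, a'), hg, hω⟩
  exact le_antisymm (le_trans (measureReal_mono hle (measure_ne_top _ _)) (by rw [measureReal_def, h0, ENNReal.toReal_zero])) measureReal_nonneg

/-- **Merging an almost surely attached relay**: for `a, a' ∈ A`, `a ≠ a'`, `a' ≠ a₀` with `μ((a ↔ a')ᶜ) = 0`,
`D(A.erase a') → D(A)` (any weighting `g`; in the application `g = u/S`).  [cite: KozmaNitzan2024, Remark after Lemma 4 p. 9] -/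
theorem dKernel_of_merge (g : Sym2 (Fin n) → unitInterval) (A S : Finset (Fin n)) (b a₀ a a' : Fin n)
    (ha : a ∈ A) (haa : a ≠ a')
    (hnull : (prodBernoulli g).real ((openConn a a')ᶜ : Set (BondConfig (Fin n))) = 0)
    (hD : (prodBernoulli g).real ((⋃ v ∈ S, ⋃ x ∈ A.erase a', openConn v x) ∩ openConn a₀ b) ≤ (prodBernoulli g).real (⋃ v ∈ S, openConn v b)) :
    (prodBernoulli g).real ((⋃ v ∈ S, ⋃ x ∈ A, openConn v x) ∩ openConn a₀ b) ≤ (prodBernoulli g).real (⋃ v ∈ S, openConn v b) := by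
  have hsub : ((⋃ v ∈ S, ⋃ x ∈ A, openConn v x) ∩ openConn a₀ b : Set (BondConfig (Fin n)))
      ⊆ ((⋃ v ∈ S, ⋃ x ∈ A.erase a', openConn v x) ∩ openConn a₀ b) ∪ (openConn a a')ᶜ := by
    intro ω hω
    obtain ⟨hU, hab⟩ := hω
    by_cases haa' : ω ∈ (openConn a a' : Set (BondConfig (Fin n)))
    · left
      refine ⟨?_, hab⟩
      simp only [Set.mem_iUnion, exists_prop] at hU ⊢
      obtain ⟨v, hv, x, hx, hvx⟩ := hU
      by_cases hxa : x = a'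
      · subst hxa
        exact ⟨v, hv, a, Finset.mem_erase.2 ⟨haa, ha⟩, blockGrowth_openConn_trans hvx (blockGrowth_openConn_symm haa')⟩
      · exact ⟨v, hv, x, Finset.mem_erase.2 ⟨hxa, hx⟩, hvx⟩
    · exact Or.inr haa'
  calc (prodBernoulli g).real ((⋃ v ∈ S, ⋃ x ∈ A, openConn v x) ∩ openConn a₀ b)
      ≤ (prodBernoulli g).real (((⋃ v ∈ S, ⋃ x ∈ A.erase a', openConn v x) ∩ openConn a₀ b) ∪ (openConn a a')ᶜ) :=
        measureReal_mono hsub (measure_ne_top _ _)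
    _ ≤ (prodBernoulli g).real ((⋃ v ∈ S, ⋃ x ∈ A.erase a', openConn v x) ∩ openConn a₀ b)
          + (prodBernoulli g).real ((openConn a a')ᶜ : Set (BondConfig (Fin n))) := measureReal_union_le _ _
    _ ≤ (prodBernoulli g).real (⋃ v ∈ S, openConn v b) := by rw [hnull, add_zero]; exact hD

end DKernelMerge

end

end Summit.CriticalPhenomena.PercolationContinuityZ3.Theorems
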